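import Literature.AlgebraicGeometry.HodgeTheory.ZariskiClosureFiniteIndex
import HarnessLib

/-!
# The Zariski closure of a finite-index subgroup has finite index in the closure: `Γ^Zar = ⋃ γᵢ (Λ)^Zar`
# on `K`-points (Borel, *Linear Algebraic Groups*, I.1.2, I.2.1; CMSP Lemma–Definition 15.3.7 "a group of
# finite index of `Γ^Zar`")

Family `hodge`, layer `Literature/AlgebraicGeometry/HodgeTheory`. THEOREMS completing the elementary
"finite-index transfer" (planner memo STUB-PLAN-B2-g19 §1 (E3a)) for the tree's `K`-points Zariski closure
`glZariskiClosure` / identity component `glIdentityComponent` (`AlgebraicMonodromyMumfordTate`), next to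
`ZariskiClosureFiniteIndex` (powers, rootable points) and `GlZariskiClosureGroup` (the closure is a group).
Written by the prover seat `hodge-nonav-prover-A` (cell `hodge-nonav`) for the crux K1
`VeryGeneralDeckCommutatorsInHg` (`stmt-HodgeConjecture-19544`).

The statements (any field `K`, `V` finite-dimensional, `Λ ≤ Γ ≤ GL(V)` with `[Γ : Λ] < ∞`):
* `mem_zariskiClosureEndOfBasis_union` — the entry-closure of `S ∪ T` lies in `cl S ∪ cl T` (a product of
  two separating polynomials separates); `exists_mem_zariskiClosureEndOfBasis_of_iUnion` — finite unions.
* `inv_mul_mem_zariskiClosureEndOfBasis_of_mem_image_mul` — translates: `f ∈ cl(γ · S) ⇒ γ⁻¹ f ∈ cl S`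
  (left multiplication is a polynomial map).
* **`exists_inv_mul_mem_glZariskiClosure_of_finiteIndex`** — `g ∈ Γ^Zar(K) ⇒ γ⁻¹ g ∈ Λ^Zar(K)` for some
  `γ ∈ Γ`, i.e. `Γ^Zar(K) = ⋃_{γΛ ∈ Γ/Λ} γ · Λ^Zar(K)` (Borel I.2.1: the closure of a finite union of
  cosets is the union of the closures).
* **`finiteIndex_glZariskiClosureSubgroup`** — `Λ^Zar(K)` has finite index in `Γ^Zar(K)` (the cosets are
  represented by `Γ/Λ`; CMSP 15.3.7: "a group of finite index of `Γ^Zar`"; Borel I.1.2);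
  `exists_mem_mul_mem_glZariskiClosure_of_finiteIndex` — `Γ^Zar(K) = Γ · Λ^Zar(K)`.

## References
* [Borel1991] A. Borel, *Linear Algebraic Groups*, 2nd ed., GTM 126 (1991): I.1.2 (identity component,
  finite-index closed subgroups), I.2.1 (closures of subgroups and of their cosets).
* [CarlsonMullerStachPeters2017] J. Carlson, S. Müller-Stach, C. Peters, *Period Mappings and Period
  Domains*, 2nd ed. (2017), Lemma–Definition 15.3.7.
-/

noncomputable section

open Literature.AlgebraicGeometry.Motives

namespace Literature.AlgebraicGeometry.HodgeTheory

/-! ### §1 Entry-closures of unions and of translates -/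

section EndClosure

universe u v

variable {K : Type u} [Field K] {V : Type v} [AddCommGroup V] [Module K V]
variable {ι : Type*} [Fintype ι] [DecidableEq ι]

/-- **`cl(S ∪ T) ⊆ cl S ∪ cl T`** for entry-closures: if `P` vanishes on `S` but not at `f` and `Q` vanishes on
`T` but not at `f`, then `P Q` vanishes on `S ∪ T` but not at `f`. [cite: Borel1991, I.2.1] -/
theorem mem_zariskiClosureEndOfBasis_union (b : Module.Basis ι K V) {S T : Set (Module.End K V)}
    {f : Module.End K V} (hf : f ∈ zariskiClosureEndOfBasis b (S ∪ T)) :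
    f ∈ zariskiClosureEndOfBasis b S ∨ f ∈ zariskiClosureEndOfBasis b T := by
  by_contra h
  rw [not_or] at h
  obtain ⟨hS, hT⟩ := h
  simp only [mem_zariskiClosureEndOfBasis_iff, not_forall, exists_prop] at hS hT
  obtain ⟨P, hPS, hPf⟩ := hS
  obtain ⟨Q, hQT, hQf⟩ := hT
  refine mul_ne_zero hPf hQf ?_
  rw [← map_mul]
  refine hf (P * Q) fun g hg => ?_
  rw [map_mul]
  rcases hg with hg | hg
  · rw [hPS g hg, zero_mul]
  · rw [hQT g hg, mul_zero]

/-- The entry-closure of the empty set is empty (the constant polynomial `1` vanishes on `∅`). [cite: Borel1991, I.2.1] -/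
theorem not_mem_zariskiClosureEndOfBasis_empty (b : Module.Basis ι K V) (f : Module.End K V) :
    f ∉ zariskiClosureEndOfBasis b (∅ : Set (Module.End K V)) := by
  intro hf
  have h := hf 1 (fun _ hg => hg.elim)
  rw [map_one] at h
  exact one_ne_zero h

/-- **Finite unions**: a point of the entry-closure of `⋃_{i ∈ s} S i` (`s` a finite set of indices) lies in the
entry-closure of some `S i`. [cite: Borel1991, I.2.1] -/
theorem exists_mem_zariskiClosureEndOfBasis_of_biUnion (b : Module.Basis ι K V) {α : Type*} (s : Finset α)
    (S : α → Set (Module.End K V)) {f : Module.End K V}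
    (hf : f ∈ zariskiClosureEndOfBasis b (⋃ i ∈ s, S i)) : ∃ i ∈ s, f ∈ zariskiClosureEndOfBasis b (S i) := by
  classical
  induction s using Finset.induction_on with
  | empty =>
    simp only [Finset.notMem_empty, Set.iUnion_of_empty, Set.iUnion_empty] at hf
    exact (not_mem_zariskiClosureEndOfBasis_empty b f hf).elim
  | insert a s ha ih =>
    rw [Finset.set_biUnion_insert] at hf
    rcases mem_zariskiClosureEndOfBasis_union b hf with h | h
    · exact ⟨a, Finset.mem_insert_self a s, h⟩
    · obtain ⟨i, hi, hfi⟩ := ih h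
      exact ⟨i, Finset.mem_insert_of_mem hi, hfi⟩

/-- Finite unions over a finite index type. [cite: Borel1991, I.2.1] -/
theorem exists_mem_zariskiClosureEndOfBasis_of_iUnion (b : Module.Basis ι K V) {α : Type*} [Finite α]
    (S : α → Set (Module.End K V)) {f : Module.End K V}
    (hf : f ∈ zariskiClosureEndOfBasis b (⋃ i, S i)) : ∃ i, f ∈ zariskiClosureEndOfBasis b (S i) := by
  classical
  haveI := Fintype.ofFinite α
  have h : (⋃ i, S i) = ⋃ i ∈ (Finset.univ : Finset α), S i := by simp
  rw [h] at hf
  obtain ⟨i, _, hi⟩ := exists_mem_zariskiClosureEndOfBasis_of_biUnion b Finset.univ S hf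
  exact ⟨i, hi⟩

/-- Left multiplication by a fixed endomorphism, in coordinates: `[c f]_b` is `C · X` evaluated at `[f]_b`.
[cite: Borel1991, I.2.1] -/
theorem toMatrix_mul_eq_mapMatrix (b : Module.Basis ι K V) (c f : Module.End K V) :
    LinearMap.toMatrix b b (c * f) =
      (MvPolynomial.eval fun ij : ι × ι => LinearMap.toMatrix b b f ij.1 ij.2).mapMatrix
        ((LinearMap.toMatrix b b c).map MvPolynomial.C * Matrix.mvPolynomialX ι ι K) := by
  rw [LinearMap.toMatrix_mul, map_mul (MvPolynomial.eval fun ij : ι × ι => LinearMap.toMatrix b b f ij.1 ij.2).mapMatrix,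
    Matrix.mvPolynomialX_mapMatrix_eval]
  congr 1
  ext i j
  simp [RingHom.mapMatrix_apply, Matrix.map_apply]

/-- **Translates**: if `f` lies in the entry-closure of the left translate `c · S` by an automorphism `c`, then
`c⁻¹ f` lies in the entry-closure of `S` (left multiplication by `c⁻¹` is a polynomial map carrying `c · S`
onto `S`). [cite: Borel1991, I.2.1] -/
theorem inv_mul_mem_zariskiClosureEndOfBasis_of_mem_image_mul (b : Module.Basis ι K V)
    {S : Set (Module.End K V)} (c : V ≃ₗ[K] V) {f : Module.End K V}
    (hf : f ∈ zariskiClosureEndOfBasis b ((fun x => (c : Module.End K V) * x) '' S)) :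
    ((c⁻¹ : V ≃ₗ[K] V) : Module.End K V) * f ∈ zariskiClosureEndOfBasis b S := by
  refine mem_zariskiClosureEndOfBasis_of_polynomialMap b
    ((LinearMap.toMatrix b b ((c⁻¹ : V ≃ₗ[K] V) : Module.End K V)).map MvPolynomial.C * Matrix.mvPolynomialX ι ι K)
    (fun x => ((c⁻¹ : V ≃ₗ[K] V) : Module.End K V) * x) (fun x => toMatrix_mul_eq_mapMatrix b _ x) ?_ hf
  rintro _ ⟨s, hs, rfl⟩
  rwa [← mul_assoc, ← LinearEquiv.coe_toLinearMap_mul, inv_mul_cancel, LinearEquiv.coe_toLinearMap_one,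
    Module.End.mul_eq_comp, LinearMap.id_comp]

end EndClosure

/-! ### §2 `Γ^Zar(K) = ⋃ γᵢ Λ^Zar(K)` for `Λ ≤ Γ` of finite index -/

section FiniteIndex

universe u v

variable {K : Type u} [Field K] {V : Type v} [AddCommGroup V] [Module K V] [Module.Finite K V]

/-- **Finite-index transfer** (Borel I.2.1; CMSP 15.3.7 "a group of finite index of `Γ^Zar`"): if `Λ` has
finite index in `Γ ≤ GL(V)`, then every point `g` of `Γ^Zar(K)` is `γ x` with `γ ∈ Γ` and `x ∈ Λ^Zar(K)` —
`Γ = ⋃_{i} γᵢ Λ` is a finite union of translates, the closure of a finite union is the union of the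
closures, and the closure of a translate is the translate of the closure. [cite: Borel1991, I.2.1]
[cite: CarlsonMullerStachPeters2017, Lemma–Definition 15.3.7] -/
theorem exists_inv_mul_mem_glZariskiClosure_of_finiteIndex {Γ Λ : Subgroup (V ≃ₗ[K] V)}
    (hfi : (Λ.subgroupOf Γ).FiniteIndex) {g : V ≃ₗ[K] V} (hg : g ∈ glZariskiClosure Γ) :
    ∃ γ ∈ Γ, γ⁻¹ * g ∈ glZariskiClosure Λ := by
  classical
  let b := Module.Free.chooseBasis K V
  -- coset representatives
  let Q := Γ ⧸ Λ.subgroupOf Γ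
  haveI : Finite Q := Subgroup.finite_quotient_of_finiteIndex
  let rep : Q → V ≃ₗ[K] V := fun q => ((Quotient.out q : Γ) : V ≃ₗ[K] V)
  have hrep : ∀ q : Q, rep q ∈ Γ := fun q => (Quotient.out q : Γ).2
  -- `Γ ⊆ ⋃_q rep q · Λ`, on underlying endomorphisms
  let SΛ : Set (Module.End K V) := (fun h : V ≃ₗ[K] V => (h : Module.End K V)) '' (Λ : Set (V ≃ₗ[K] V))
  have hcover : (fun h : V ≃ₗ[K] V => (h : Module.End K V)) '' (Γ : Set (V ≃ₗ[K] V)) ⊆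
      ⋃ q : Q, (fun x => (rep q : Module.End K V) * x) '' SΛ := by
    rintro _ ⟨γ, hγ, rfl⟩
    let q : Q := QuotientGroup.mk (⟨γ, hγ⟩ : Γ)
    have hq : ((Quotient.out q : Γ) : V ≃ₗ[K] V)⁻¹ * γ ∈ Λ := by
      have h : (QuotientGroup.mk (Quotient.out q) : Q) = QuotientGroup.mk (⟨γ, hγ⟩ : Γ) := QuotientGroup.out_eq' q
      rw [QuotientGroup.eq, Subgroup.mem_subgroupOf] at h
      simpa using h
    refine Set.mem_iUnion.2 ⟨q, ⟨(((rep q)⁻¹ * γ : V ≃ₗ[K] V) : Module.End K V), ⟨(rep q)⁻¹ * γ, hq, rfl⟩, ?_⟩⟩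
    change (rep q : Module.End K V) * (((rep q)⁻¹ * γ : V ≃ₗ[K] V) : Module.End K V) = (γ : Module.End K V)
    rw [← LinearEquiv.coe_toLinearMap_mul, mul_inv_cancel_left]
  -- `g` lies in the closure of the finite union, hence of one translate
  rw [mem_glZariskiClosure_iff, ← zariskiClosureEnd_basis_indep b] at hg
  obtain ⟨q, hq⟩ := exists_mem_zariskiClosureEndOfBasis_of_iUnion b
    (fun q : Q => (fun x => (rep q : Module.End K V) * x) '' SΛ) (zariskiClosureEndOfBasis_mono b hcover hg)
  refine ⟨rep q, hrep q, ?_⟩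
  rw [mem_glZariskiClosure_iff, ← zariskiClosureEnd_basis_indep b, LinearEquiv.coe_toLinearMap_mul]
  exact inv_mul_mem_zariskiClosureEndOfBasis_of_mem_image_mul b (rep q) hq

/-- **`Λ^Zar(K)` has finite index in `Γ^Zar(K)`** for `Λ` of finite index in `Γ` (Borel I.1.2, I.2.1; CMSP
15.3.7): the cosets of `Λ^Zar(K)` in `Γ^Zar(K)` are represented by `Γ`, and `Λ`-equivalent representatives
give the same coset. [cite: Borel1991, I.1.2 and I.2.1] [cite: CarlsonMullerStachPeters2017, Lemma–Definition 15.3.7] -/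
theorem finiteIndex_glZariskiClosureSubgroup {Γ Λ : Subgroup (V ≃ₗ[K] V)}
    (hfi : (Λ.subgroupOf Γ).FiniteIndex) :
    ((glZariskiClosureSubgroup Λ).subgroupOf (glZariskiClosureSubgroup Γ)).FiniteIndex := by
  classical
  let G := glZariskiClosureSubgroup Γ
  let GΛ := (glZariskiClosureSubgroup Λ).subgroupOf G
  haveI : Finite (Γ ⧸ Λ.subgroupOf Γ) := Subgroup.finite_quotient_of_finiteIndex
  -- the map `Γ/Λ → G/GΛ`
  let ι₀ : Γ → G := fun γ => ⟨γ, le_glZariskiClosureSubgroup Γ γ.2⟩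
  let f : Γ ⧸ Λ.subgroupOf Γ → G ⧸ GΛ := Quotient.lift (fun γ : Γ => (QuotientGroup.mk (ι₀ γ) : G ⧸ GΛ))
    (fun a c hac => by
      have hac' : a⁻¹ * c ∈ Λ.subgroupOf Γ := QuotientGroup.leftRel_apply.mp hac
      rw [Subgroup.mem_subgroupOf] at hac'
      refine QuotientGroup.eq.2 ?_
      rw [Subgroup.mem_subgroupOf]
      exact le_glZariskiClosureSubgroup Λ (hac' : ((a⁻¹ * c : Γ) : V ≃ₗ[K] V) ∈ Λ))
  have hf : Function.Surjective f := by
    intro x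
    induction x using QuotientGroup.induction_on with
    | H z =>
      obtain ⟨γ, hγ, hγz⟩ := exists_inv_mul_mem_glZariskiClosure_of_finiteIndex hfi
        ((mem_glZariskiClosureSubgroup_iff Γ _).1 z.2)
      refine ⟨QuotientGroup.mk (⟨γ, hγ⟩ : Γ), ?_⟩
      change (QuotientGroup.mk (ι₀ ⟨γ, hγ⟩) : G ⧸ GΛ) = QuotientGroup.mk z
      refine QuotientGroup.eq.2 ?_
      rw [Subgroup.mem_subgroupOf]
      exact hγz
  haveI : Finite (G ⧸ GΛ) := Finite.of_surjective f hf
  exact Subgroup.finiteIndex_of_finite_quotient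

/-- **`(Γ^Zar)°(K) ⊆ Λ^Zar(K)` has a companion: `Λ^Zar(K) ⊇ (Γ^Zar)°(K)` is already the definition; here the
finite-index closed subgroup `Λ^Zar` of `Γ^Zar` CONTAINS every point of `Γ^Zar` up to a translate by `Γ`** —
restated as: the natural map `Γ → Γ^Zar(K)/Λ^Zar(K)` is onto. [cite: Borel1991, I.1.2 and I.2.1] -/
theorem exists_mem_mul_mem_glZariskiClosure_of_finiteIndex {Γ Λ : Subgroup (V ≃ₗ[K] V)}
    (hfi : (Λ.subgroupOf Γ).FiniteIndex) {g : V ≃ₗ[K] V} (hg : g ∈ glZariskiClosure Γ) :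
    ∃ γ ∈ Γ, ∃ x ∈ glZariskiClosure Λ, g = γ * x := by
  obtain ⟨γ, hγ, hx⟩ := exists_inv_mul_mem_glZariskiClosure_of_finiteIndex hfi hg
  exact ⟨γ, hγ, γ⁻¹ * g, hx, by rw [mul_inv_cancel_left]⟩

end FiniteIndex

end Literature.AlgebraicGeometry.HodgeTheory

end
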